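import Mathlib.Algebra.QuadraticAlgebra.Basic
import Mathlib.NumberTheory.RamificationInertia.Valuation
import Mathlib.Topology.Algebra.UniformRing
import Literature.NumberTheory.Automorphic.QuaternionAlgebraLocalUniqueness
import Literature.NumberTheory.Automorphic.QuaternionRamificationParity
import HarnessLib

/-!
# The embedding criterion for quadratic fields (Vignéras III Thm. 3.8 (1)), reduced to the
# local norm index and Hasse's norm theorem

Companion ("proofs") file of `QuaternionAlgebraEmbedding` for its named fact
`exists_sq_eq_of_not_isSquare_ramified K D` (Vignéras, LNM 800, Ch. III §3 Thm. 3.8, first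
assertion: *if `K(√a)_v` is a field for every `v ∈ Ram(D)` then `K(√a)` embeds in `D`*), the
last of the three leaves of the uniqueness theorem III Thm. 3.1
(`nonempty_algEquiv_of_ramifiedPlaces_eq`, see `QuaternionAlgebraUniqueness`,
`QuaternionAlgebraLocalUniqueness`).

We prove it (`exists_sq_eq_of_not_isSquare_ramified_of_facts`) from the two class-field-theoretic
inputs already isolated by the sibling files, and nothing else:

* the local norm index `(K_vˣ : N(K_v(√a)ˣ)) = 2` for non-squares `a ∈ K_v` (O'Meara 63:13a; in
  the vocabulary `quadraticNormSubgroup` of `QuadraticNormIndex`) at the finite places `v` of `K`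
  ramified in `D` — proved at every `v ∤ 2` in `QuadraticNormIndexLocal`, and a consequence of the
  fundamental equality of local class field theory (the named fact `index_normSubgroup_eq_finrank`
  of `LocalExistenceTheorem`) at every `v`, `QuadraticNormLocalCFT`;
* `Literature.hilbertSymbol_eq_one_of_forall_completions L c d` — Hasse's norm theorem for quadratic
  extensions (Vignéras III Cor. 3.4), for the quadratic field `L = K(√a)` (a number field).

The route is Vignéras' Cor. 3.5 (*`L` neutralise `H` iff `L_w` neutralise `H_v` pour toute place
`w | v`*) made explicit with Hilbert symbols. Write `D ≃ ℍ[K,c,d]` (`QuaternionAlgebraStructure`)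
and `L = K(√a)` (Mathlib `QuadraticAlgebra K a 0`, a number field).

1. **Local splitting over `L`.** For every place `w` of `L` over `v` of `K`, `(c, d)_{L_w} = 1`:
   if `v ∉ Ram(D)` because `(c, d)_{K_v} = 1` persists along `K_v → L_w`
   (`exists_ringHom_adicCompletion_algebraMap`, built from Mathlib's
   `IsDedekindDomain.HeightOneSpectrum.uniformContinuous_algebraMap_liesOver`; at the infinite
   places through the real embeddings, `HilbertSymbolArchimedean`); if `v ∈ Ram(D)` is finite,
   because `a ∉ K_v²` and the local norm index give `c₀` with `c₀/d ∈ n(K_v(√c))`,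
   `a/c ∈ n(K_v(√c₀))` (`exists_isNormFromSqrt_chain` of `QuaternionAlgebraLocalUniqueness` —
   the algebra of II Thm. 1.1: `ℍ_{K_v}(c,d) ≃ ℍ_{K_v}(a,t)`), relations which in `L_w ∋ √a`
   force `d ∈ n(L_w(√c))`; and a real place `v ∈ Ram_∞(D)` has no real place of `L` above it
   (`a < 0` at `v`).
2. **Hasse over `L`** (`hilbertSymbol_eq_one_of_forall_completions L c d`): `(c, d)_L = 1`, i.e.
   `L ⊗_K D ≃ ℍ[L,c,d] ≃ M₂(L)` — `L` splits `D`.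
3. **`L` splits `D` ⇒ `L ↪ D`** (`exists_mul_self_eq_of_split_scalarExtension`, pure algebra):
   if `D` is a division algebra, `L ⊗_K D ≃ M₂(L)` makes `V = L²` a `D`-module of `K`-dimension
   `4 = dim_K D`, so `d ↦ d v₀` is a `K`-linear bijection `D → V` intertwining `√a ∈ L` with an
   element `x ∈ D`, `x² = a`; if `D ≃ M₂(K)`, `x = (0 a; 1 0)`.

Assemblies: `exists_sq_eq_of_not_isSquare_ramified_of_facts` (III Thm. 3.8 (1) from 63:13a at
the ramified places of `K` and Cor. 3.4 over the quadratic fields `K(√a)`), its special case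
`exists_sq_eq_of_not_isSquare_ramified_of_hasseNorm_of_not_dyadic` needing only Cor. 3.4 (no
dyadic place ramified in `D`), and the end results of the whole decomposition,
`nonempty_algEquiv_of_ramifiedPlaces_eq_of_index_eq_two_of_hasseNorm`,
`nonempty_algEquiv_of_ramifiedPlaces_eq_of_dyadic_index_eq_two_of_hasseNorm` and
`nonempty_algEquiv_of_ramifiedPlaces_eq_of_localCFT_of_hasseNorm`:
**Vignéras III Thm. 3.1 (uniqueness) follows from the local norm index 63:13a at the dyadic places
of number fields (a case of the local fundamental equality `index_normSubgroup_eq_finrank`) and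
Hasse's norm theorem for quadratic extensions of number fields; all other inputs of the book's
proof are proved.** All declarations in this file are theorems.

## References

* M.-F. Vignéras, *Arithmétique des algèbres de quaternions*, LNM 800 (1980), Ch. II §1
  Thm. 1.1, Cor. 1.9; Ch. III §3 Thm. 3.1, Cor. 3.4, Cor. 3.5, Thm. 3.8.
* O. T. O'Meara, *Introduction to quadratic forms*, Grundlehren 117 (1963), §63B, 63:13a.
-/

noncomputable section

open scoped Quaternion
open NumberField IsDedekindDomain

universe u v

namespace Literature.NumberTheory.Automorphic

/-! ### Norms and Hilbert symbols along ring homomorphisms -/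

section Map

variable {F E : Type*} [Field F] [Field E]

/-- Norms from `F(√a)` map to norms from `E(√(f a))` along a ring homomorphism `f : F → E`.
[folklore] -/
theorem IsNormFromSqrt.map (f : F →+* E) {a θ : F} (h : IsNormFromSqrt a θ) :
    IsNormFromSqrt (f a) (f θ) := by
  obtain ⟨x, y, rfl⟩ := isNormFromSqrt_iff.mp h
  exact isNormFromSqrt_iff.mpr ⟨f x, f y, by simp [map_sub, map_mul, map_pow]⟩

/-- `(a, b)_F = 1` implies `(f a, f b)_E = 1` along a ring homomorphism `f : F → E` (a solution of
`a X² + b Y² = 1` is mapped to one). [folklore] -/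
theorem hilbertSymbol_map_eq_one (f : F →+* E) {a b : F} (h : QuadraticForms.hilbertSymbol F a b = 1) :
    QuadraticForms.hilbertSymbol E (f a) (f b) = 1 := by
  obtain ⟨x, y, hxy⟩ := (QuadraticForms.hilbertSymbol_eq_one_iff a b).mp h
  exact (QuadraticForms.hilbertSymbol_eq_one_iff _ _).mpr ⟨f x, f y, by simpa using congrArg f hxy⟩

/-- A square is a norm from every `F(√c)`: `s² = s² - c·0²`. [folklore] -/
theorem IsNormFromSqrt.of_mul_self (c s : F) : IsNormFromSqrt c (s * s) :=
  isNormFromSqrt_iff.mpr ⟨s, 0, by ring⟩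

/-- **The ramified local step of Cor. 3.5.** In a field `E` with `2 ≠ 0`: if `c d c₀ a ≠ 0`,
`c₀/d ∈ n(E(√c))`, `a/c ∈ n(E(√c₀))` and `a = s²` is a square, then `d ∈ n(E(√c))`, i.e.
`(c, d)_E = 1`. (With `E = L_w ⊇ K_v` and the chain data of `ℍ_{K_v}(c,d) ≃ ℍ_{K_v}(a,t)`: a
quadratic extension containing `√a` splits the quaternion division algebra of `K_v`, Vignéras II
Cor. 1.9 / Thm. 1.3.) [folklore] -/
theorem isNormFromSqrt_of_chain_of_sq [NeZero (2 : E)] {c d c₀ a s : E} (hc : c ≠ 0)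
    (hd : d ≠ 0) (hc₀ : c₀ ≠ 0) (ha : a ≠ 0) (h₁ : IsNormFromSqrt c (c₀ / d))
    (h₃ : IsNormFromSqrt c₀ (a / c)) (hs : a = s * s) : IsNormFromSqrt c d := by
  -- `a ∈ n(E(√c₀))`, hence `c = a / (a/c) ∈ n(E(√c₀))`, hence `c₀ ∈ n(E(√c))` by symmetry
  have hac₀ : IsNormFromSqrt c₀ a := hs ▸ IsNormFromSqrt.of_mul_self c₀ s
  have hcc₀ : IsNormFromSqrt c₀ c := by
    have h := hac₀.div h₃
    rwa [show a / (a / c) = c by field_simp] at h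
  have hc₀c : IsNormFromSqrt c c₀ := hcc₀.symm_of hc₀ hc
  -- `d = c₀ / (c₀/d)`
  have h := hc₀c.div h₁
  rwa [show c₀ / (c₀ / d) = d by field_simp] at h

end Map

/-! ### `L` splits `D` implies `L ↪ D` -/

section SplitEmbeds

variable {K : Type*} [Field K] {D : Type*} [Ring D] [Algebra K D]
variable {L : Type*} [Field L] [Algebra K L]

/-- **A quadratic field splitting a quaternion division algebra embeds in it** (the step
`L ⊗ H ≃ M(2,L) ⇒ L ↪ H` in Vignéras III Thm. 3.8 via Cor. 3.5; I §2). Let `D` be a division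
algebra of dimension `4` over `K`, `L/K` of degree `2`, and `φ : L ⊗_K D ≃ M₂(L)`. Then `V = L²`
is a left `D`-module through `ρ = φ ∘ (1 ⊗ ·)`, commuting with the `L`-scalars; `T : d ↦ ρ(d) v₀`
(`v₀ ≠ 0`) is `K`-linear and injective (`D` is a division ring), hence bijective as
`dim_K V = 2·2 = 4 = dim_K D`. If `r ∈ L`, `r² = a ∈ K`, the unique `x ∈ D` with `T x = r v₀`
satisfies `T(x²) = ρ(x)(r v₀) = r ρ(x) v₀ = r² v₀ = T(a)`, so `x² = a`. [cite: VignerasLNM800, Ch. III §3 Thm. 3.8] -/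
theorem exists_mul_self_eq_of_split_scalarExtension (hD : ∀ x : D, x ≠ 0 → IsUnit x)
    (h4 : Module.finrank K D = 4) (hL : Module.finrank K L = 2)
    (φ : ScalarExtension K L D ≃ₐ[L] Matrix (Fin 2) (Fin 2) L) {a : K} {r : L}
    (hr : r * r = algebraMap K L a) : ∃ x : D, x * x = algebraMap K D a := by
  -- the representation `ρ : D → M₂(L)` and the orbit map `T d = ρ d • v₀`
  let ρ : D →ₐ[K] Matrix (Fin 2) (Fin 2) L :=
    (φ.restrictScalars K).toAlgHom.comp (ScalarExtension.incl K L D)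
  let v₀ : Fin 2 → L := Pi.single 0 1
  let T : D →ₗ[K] (Fin 2 → L) :=
    { toFun := fun d ↦ (ρ d).mulVec v₀
      map_add' := fun x y ↦ by simp only [map_add, Matrix.add_mulVec]
      map_smul' := fun k x ↦ by
        simp only [map_smul, RingHom.id_apply, Matrix.smul_mulVec] }
  have hT : ∀ d, T d = (ρ d).mulVec v₀ := fun d ↦ rfl
  have hTmul : ∀ d d', T (d * d') = (ρ d).mulVec (T d') := fun d d' ↦ by
    rw [hT, hT, map_mul, ← Matrix.mulVec_mulVec]
  have hv₀ : v₀ ≠ 0 := fun h ↦ by simpa [v₀] using congr_fun h 0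
  have hT1 : T 1 = v₀ := by rw [hT, map_one, Matrix.one_mulVec]
  -- `T` is injective: a non-zero `d` is a unit, and `T d = 0` would give `v₀ = T (d⁻¹ d) = 0`
  have hinj : Function.Injective T := by
    rw [injective_iff_map_eq_zero]
    intro d hd
    by_contra hd0
    obtain ⟨u, rfl⟩ := hD d hd0
    apply hv₀
    calc v₀ = T 1 := hT1.symm
      _ = T ((↑u⁻¹ : D) * ↑u) := by rw [Units.inv_mul]
      _ = (ρ ↑u⁻¹).mulVec (T ↑u) := hTmul _ _
      _ = 0 := by rw [hd, Matrix.mulVec_zero]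
  -- dimension count `dim_K L² = 4 = dim_K D`, so `T` is onto
  haveI : FiniteDimensional K L := Module.finite_of_finrank_pos (by omega)
  haveI : FiniteDimensional K D := Module.finite_of_finrank_pos (by omega)
  have hdim : Module.finrank K (Fin 2 → L) = 4 := by
    rw [Module.finrank_pi_fintype, Finset.sum_const, Finset.card_univ, Fintype.card_fin, hL,
      smul_eq_mul]
  have hsurj : Function.Surjective T :=
    (LinearMap.injective_iff_surjective_of_finrank_eq_finrank (by rw [h4, hdim])).mp hinj
  obtain ⟨x, hx⟩ := hsurj (r • v₀)
  refine ⟨x, hinj ?_⟩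
  have lhs : T (x * x) = algebraMap K L a • v₀ := by
    rw [hTmul, hx, Matrix.mulVec_smul, ← hT, hx, smul_smul, hr]
  have rhs : T (algebraMap K D a) = algebraMap K L a • v₀ := by
    rw [hT, AlgHom.commutes, Algebra.algebraMap_eq_smul_one, Matrix.smul_mulVec,
      Matrix.one_mulVec, algebraMap_smul]
  exact lhs.trans rhs.symm

/-- In `M₂(K)` every `a ∈ K` is a square: `(0 a; 1 0)² = a`. Hence a split quaternion algebra
`D ≃ M₂(K)` contains `x` with `x² = a`. [folklore] -/
theorem exists_mul_self_eq_of_split (e : D ≃ₐ[K] Matrix (Fin 2) (Fin 2) K) (a : K) :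
    ∃ x : D, x * x = algebraMap K D a := by
  refine ⟨e.symm !![0, a; 1, 0], e.injective ?_⟩
  rw [map_mul, e.apply_symm_apply, AlgEquiv.commutes]
  ext i j
  fin_cases i <;> fin_cases j <;> simp [Matrix.mul_apply, Matrix.algebraMap_matrix_apply]

variable (K) (D) in
/-- **`L` splits `D` ⇒ `L ↪ D`** for a quaternion algebra `D` over `K` and `L/K` of degree `2`:
if `L ⊗_K D ≃ M₂(L)` and `r² = a` in `L` (`a ∈ K`) then some `x ∈ D` has `x² = a`. The
division case is `exists_mul_self_eq_of_split_scalarExtension`, the split case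
`exists_mul_self_eq_of_split` (dichotomy `IsQuaternionAlgebra.division_or_split`, I Cor. 2.4).
[cite: VignerasLNM800, Ch. III §3 Thm. 3.8] -/
theorem exists_mul_self_eq_of_nonempty_algEquiv_matrix [IsQuaternionAlgebra K D]
    (L : Type*) [Field L] [Algebra K L] (hL : Module.finrank K L = 2) {a : K} {r : L}
    (hr : r * r = algebraMap K L a)
    (h : Nonempty (ScalarExtension K L D ≃ₐ[L] Matrix (Fin 2) (Fin 2) L)) :
    ∃ x : D, x * x = algebraMap K D a := by
  rcases IsQuaternionAlgebra.division_or_split K D with hdiv | hsplit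
  · exact exists_mul_self_eq_of_split_scalarExtension hdiv
      (IsQuaternionAlgebra.finrank_eq_four (K := K) (D := D)) hL h.some hr
  · obtain ⟨e⟩ := hsplit
    exact exists_mul_self_eq_of_split e a

end SplitEmbeds

/-! ### Completions of `L ⊇ K` at finite places: the map `K_v → L_w` for `w ∣ v` -/

section Completion

variable (K L : Type*) [Field K] [NumberField K] [Field L] [NumberField L] [Algebra K L]
variable (w : HeightOneSpectrum (𝓞 L)) (v : HeightOneSpectrum (𝓞 K)) [w.asIdeal.LiesOver v.asIdeal]

/-- For a finite place `w` of `L` above the finite place `v` of `K` there is a ring homomorphism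
`K_v →+* L_w` extending `K → L` (Vignéras III §3, proof of Cor. 3.5: `L_w ⊇ K_v` for `v = w|_K`):
`K → L` is uniformly continuous for the `v`- and `w`-adic uniformities (Mathlib
`IsDedekindDomain.HeightOneSpectrum.uniformContinuous_algebraMap_liesOver`, `w(x) = v(x)^{e(w|v)}`),
so it extends to the completions (Mathlib `UniformSpace.Completion.mapRingHom`, transported
along `adicCompletion.equiv`), compatibly with the two embeddings. [folklore] -/
theorem exists_ringHom_adicCompletion_algebraMap :
    ∃ f : v.adicCompletion K →+* w.adicCompletion L, ∀ x : K,
      f (algebraMap K (v.adicCompletion K) x) = algebraMap L (w.adicCompletion L) (algebraMap K L x) := by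
  have huc := HeightOneSpectrum.uniformContinuous_algebraMap_liesOver K L v w
  let f : v.adicCompletion K →+* w.adicCompletion L :=
    (HeightOneSpectrum.adicCompletion.equiv L w).symm.toRingHom.comp <|
      (UniformSpace.Completion.mapRingHom
        (algebraMap (WithVal (v.valuation K)) (WithVal (w.valuation L))) huc.continuous).comp
      (HeightOneSpectrum.adicCompletion.equiv K v).toRingHom
  refine ⟨f, fun x ↦ ?_⟩
  apply HeightOneSpectrum.adicCompletion.ext
  simp only [f, RingHom.coe_comp, Function.comp_apply, RingEquiv.toRingHom_eq_coe,
    RingEquiv.coe_toRingHom, UniformSpace.Completion.mapRingHom_apply]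
  rw [show ∀ z, ((HeightOneSpectrum.adicCompletion.equiv L w).symm z).toCompletion = z from
    fun z ↦ rfl]
  rw [show (HeightOneSpectrum.adicCompletion.equiv K v) (algebraMap K (v.adicCompletion K) x) =
      ((WithVal.toVal (v.valuation K) x : WithVal (v.valuation K)) : (v.valuation K).Completion)
    from rfl]
  rw [UniformSpace.Completion.map_coe huc]
  simp [WithVal.algebraMap_left_apply, WithVal.algebraMap_right_apply,
    HeightOneSpectrum.algebraMap_adicCompletion_toCompletion, UniformSpace.Completion.algebraMap_def]

end Completion

/-! ### The quadratic field `K(√a)` as a number field -/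

section QuadraticField

variable (K : Type*) (a : K)

/-- For `a` a non-square, `X² - a` has no root: the `Fact` making Mathlib's
`QuadraticAlgebra K a 0 = K[X]/(X² - a)` a field. [folklore] -/
theorem fact_sq_ne_of_not_isSquare [CommRing K] (ha : ¬ IsSquare a) :
    Fact (∀ r : K, r ^ 2 ≠ a + 0 * r) :=
  ⟨fun r h ↦ ha ⟨r, by rw [zero_mul, add_zero] at h; rw [← h, sq]⟩⟩

/-- `K(√a)` is a number field if `K` is and `a ∉ K²` (characteristic `0`, degree `2` over `K`).
Not an instance (use `haveI`). [folklore] -/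
theorem QuadraticAlgebra.numberField [Field K] [NumberField K] [Fact (∀ r : K, r ^ 2 ≠ a + 0 * r)] :
    NumberField (QuadraticAlgebra K a 0) :=
  haveI : CharZero (QuadraticAlgebra K a 0) :=
    charZero_of_injective_algebraMap (algebraMap K _).injective
  { to_charZero := inferInstance
    to_finiteDimensional := Module.Finite.trans K (QuadraticAlgebra K a 0) }

/-- `ω² = a` in `K(√a) = QuadraticAlgebra K a 0`. [folklore] -/
theorem QuadraticAlgebra.omega_mul_omega_eq_algebraMap [Field K] :
    (QuadraticAlgebra.omega : QuadraticAlgebra K a 0) * QuadraticAlgebra.omega =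
      algebraMap K (QuadraticAlgebra K a 0) a := by
  ext <;> simp [QuadraticAlgebra.algebraMap_eq]

end QuadraticField

/-! ### Squares at a real place -/

section RealPlace

variable {K : Type*} [Field K] {w : InfinitePlace K}

/-- At a real place `w` with real embedding `σ_w`, an element `a` with `σ_w(a) ≥ 0` is a square in
`K_w ≃ ℝ`. [folklore] -/
theorem isSquare_completion_of_embedding_nonneg (hw : w.IsReal) {a : K}
    (h : 0 ≤ InfinitePlace.embedding_of_isReal hw a) :
    IsSquare (algebraMap K w.Completion a) := by
  let e := InfinitePlace.Completion.ringEquivRealOfIsReal hw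
  have he : e (algebraMap K w.Completion a) = InfinitePlace.embedding_of_isReal hw a :=
    QuadraticForms.ringEquivRealOfIsReal_algebraMap hw a
  refine ⟨e.symm (Real.sqrt (InfinitePlace.embedding_of_isReal hw a)), ?_⟩
  apply e.injective
  rw [he, map_mul, e.apply_symm_apply, Real.mul_self_sqrt h]

end RealPlace

/-! ### Vignéras III Thm. 3.8 (1) from the local norm index and Hasse's norm theorem -/

section NumberField

variable (K : Type) [Field K] [NumberField K] (D : Type u) [Ring D] [Algebra K D]

/-- **Local splitting of `D ≃ ℍ[K,c,d]` over `L ∋ √a` at the finite places** (Vignéras III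
Cor. 3.5 with II Cor. 1.9, in Hilbert symbols). Let `L/K` be an extension of number fields
containing `r` with `r² = a`, `w` a finite place of `L` over `v`. If `v ∉ Ram(D)` then
`(c, d)_{K_v} = 1` gives `(c, d)_{L_w} = 1` along `K_v → L_w`. If `v ∈ Ram(D)` and `a ∉ K_v²`,
the local norm index at `v` (hypothesis `hI`, O'Meara 63:13a at the places ramified in `D`)
provides `t ∉ n(K_v(√a))` and the chain data `c₀` of `exists_isNormFromSqrt_chain` for the two
division algebras `ℍ_{K_v}(c,d)`, `ℍ_{K_v}(a,t)`; mapped to `L_w`, where `a = r²`, they give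
`d ∈ n(L_w(√c))` (`isNormFromSqrt_of_chain_of_sq`). [cite: VignerasLNM800, Ch. III §3 Cor. 3.5] -/
theorem hilbertSymbol_adicCompletion_extension_eq_one [IsQuaternionAlgebra K D]
    (hI : ∀ v ∈ ramifiedPlaces K D, ∀ x : v.adicCompletion K, x ≠ 0 → ¬ IsSquare x →
      (QuadraticForms.quadraticNormSubgroup (v.adicCompletion K) x).index = 2)
    {c d : K} (hc : c ≠ 0) (hd : d ≠ 0) (e : D ≃ₐ[K] ℍ[K,c,d]) {a : K}
    (hfin : ∀ v ∈ ramifiedPlaces K D, ¬ IsSquare (algebraMap K (v.adicCompletion K) a))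
    (L : Type) [Field L] [NumberField L] [Algebra K L] {r : L} (hr : r * r = algebraMap K L a)
    (w : HeightOneSpectrum (𝓞 L)) :
    QuadraticForms.hilbertSymbol (w.adicCompletion L) (algebraMap L _ (algebraMap K L c))
      (algebraMap L _ (algebraMap K L d)) = 1 := by
  let v : HeightOneSpectrum (𝓞 K) := w.under (𝓞 K)
  haveI : w.asIdeal.LiesOver v.asIdeal := ⟨rfl⟩
  obtain ⟨f, hf⟩ := exists_ringHom_adicCompletion_algebraMap K L w v
  rw [← hf, ← hf]
  by_cases hv : IsSplitAt D v
  · -- unramified: `(c,d)_{K_v} = 1` persists in `L_w`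
    exact hilbertSymbol_map_eq_one f ((isSplitAt_iff_hilbertSymbol_eq_one K D hc hd e v).mp hv)
  · -- ramified: the chain data in `K_v`, read in `L_w ∋ √a`
    haveI : CharZero (v.adicCompletion K) :=
      charZero_of_injective_algebraMap (algebraMap K _).injective
    haveI : CharZero (w.adicCompletion L) :=
      charZero_of_injective_algebraMap (algebraMap L _).injective
    have hvram : v ∈ ramifiedPlaces K D := by simpa [mem_ramifiedPlaces_iff] using hv
    set cv := algebraMap K (v.adicCompletion K) c with hcv
    set dv := algebraMap K (v.adicCompletion K) d with hdv
    have hcv0 : cv ≠ 0 := (map_ne_zero _).mpr hc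
    have hdv0 : dv ≠ 0 := (map_ne_zero _).mpr hd
    have hasq : ¬ IsSquare (algebraMap K (v.adicCompletion K) a) := hfin v hvram
    have hav0 : algebraMap K (v.adicCompletion K) a ≠ 0 := fun h ↦ hasq ⟨0, by rw [h, mul_zero]⟩
    -- `d ∉ n(K_v(√c))` since `D_v` is not split
    have hcd : ¬ IsNormFromSqrt cv dv := fun h ↦ hv <|
      (isSplitAt_iff_hilbertSymbol_eq_one K D hc hd e v).mpr
        ((isNormFromSqrt_iff_hilbertSymbol_eq_one hcv0 hdv0).mp h)
    -- the norm index at `v`: a non-norm `t` from `K_v(√a)`, and the coset property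
    obtain ⟨t, ht0, hat⟩ := exists_not_isNormFromSqrt_of_index_eq_two (hI v hvram _ hav0 hasq)
    obtain ⟨c₀, hc₀, h₁, -, h₃⟩ := exists_isNormFromSqrt_chain
      (fun x _ _ hx hxsq hθ hθ' hn hn' ↦
        isNormFromSqrt_div_of_index_eq_two (hI v hvram x hx hxsq) hθ hθ' hn hn')
      hcv0 hdv0 hav0 ht0 hcd hat
    -- read in `L_w`
    have key : IsNormFromSqrt (f cv) (f dv) :=
      isNormFromSqrt_of_chain_of_sq ((map_ne_zero f).mpr hcv0) ((map_ne_zero f).mpr hdv0)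
        ((map_ne_zero f).mpr hc₀) ((map_ne_zero f).mpr hav0)
        (by simpa [map_div₀] using h₁.map f) (by simpa [map_div₀] using h₃.map f)
        (s := algebraMap L (w.adicCompletion L) r)
        (by rw [hf, ← hr, map_mul])
    exact (isNormFromSqrt_iff_hilbertSymbol_eq_one ((map_ne_zero f).mpr hcv0)
      ((map_ne_zero f).mpr hdv0)).mp key

/-- **Local splitting of `D ≃ ℍ[K,c,d]` over `L ∋ √a` at the infinite places.** Let `w'` be an
infinite place of `L` above `w` of `K`. If `w'` is complex, `(c, d)_{L_{w'}} = 1`. If `w'` is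
real, so is `w`, with `σ_w = σ_{w'}|_K`; `σ_w(a) = σ_{w'}(r)² ≥ 0` makes `a` a square in `K_w`, so
`w ∉ Ram_∞(D)` by hypothesis, `(c, d)_{K_w} = 1`, i.e. `σ_w(c) > 0` or `σ_w(d) > 0`, and the same
signs at `w'` give `(c, d)_{L_{w'}} = 1` (`HilbertSymbolArchimedean`).
[cite: VignerasLNM800, Ch. III §3 Cor. 3.5] -/
theorem hilbertSymbol_infinitePlace_extension_eq_one
    {c d : K} (hc : c ≠ 0) (hd : d ≠ 0) (e : D ≃ₐ[K] ℍ[K,c,d]) {a : K}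
    (hinf : ∀ w ∈ ramifiedInfinitePlaces K D, ¬ IsSquare (algebraMap K w.Completion a))
    (L : Type*) [Field L] [Algebra K L] {r : L} (hr : r * r = algebraMap K L a)
    (w' : InfinitePlace L) :
    QuadraticForms.hilbertSymbol w'.Completion (algebraMap L _ (algebraMap K L c))
      (algebraMap L _ (algebraMap K L d)) = 1 := by
  rcases w'.isReal_or_isComplex with hw' | hw'
  · -- real place of `L`, over the real place `w` of `K`
    set w : InfinitePlace K := w'.comap (algebraMap K L) with hw_def
    have hw : w.IsReal := InfinitePlace.IsReal.comap _ hw'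
    have hemb : ∀ x : K, InfinitePlace.embedding_of_isReal hw' (algebraMap K L x) =
        InfinitePlace.embedding_of_isReal hw x := fun x ↦ by
      apply Complex.ofReal_injective
      rw [InfinitePlace.embedding_of_isReal_apply, InfinitePlace.embedding_of_isReal_apply,
        hw_def, InfinitePlace.comap_embedding_of_isReal _ (hw_def ▸ hw), RingHom.comp_apply]
    -- `w ∉ Ram_∞(D)`: `σ_w(a) = σ_{w'}(r)² ≥ 0`, so `a` is a square in `K_w`
    have hsplit : IsSplitAtInfinite D w := by
      by_contra hram
      refine hinf w (by simpa [mem_ramifiedInfinitePlaces_iff] using hram)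
        (isSquare_completion_of_embedding_nonneg hw ?_)
      rw [← hemb, ← hr, map_mul]
      exact mul_self_nonneg _
    have hsym := (isSplitAtInfinite_iff_hilbertSymbol_eq_one K D hc hd e w).mp hsplit
    rw [QuadraticForms.hilbertSymbol_completion_eq_one_iff_of_isReal hw] at hsym
    rw [QuadraticForms.hilbertSymbol_completion_eq_one_iff_of_isReal hw', hemb, hemb]
    exact hsym
  · exact QuadraticForms.hilbertSymbol_completion_eq_one_of_isComplex hw'
      (Or.inl ((map_ne_zero _).mpr hc))

/-- **`L = K(√a)` splits `D`** (Vignéras III Cor. 3.5 for `D ≃ ℍ[K,c,d]` and a quadratic field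
`L ∋ √a` with `a ∉ K_v²` on `Ram(D)`): granted the local norm index at the ramified finite
places of `K` (`hI`) and Hasse's norm theorem over `L`
(`hilbertSymbol_eq_one_of_forall_completions L c d`), `(c, d)_L = 1`, i.e. `L ⊗_K D ≃ M₂(L)`.
[cite: VignerasLNM800, Ch. III §3 Cor. 3.5] -/
theorem nonempty_algEquiv_matrix_scalarExtension_of_facts [IsQuaternionAlgebra K D]
    (hI : ∀ v ∈ ramifiedPlaces K D, ∀ x : v.adicCompletion K, x ≠ 0 → ¬ IsSquare x →
      (QuadraticForms.quadraticNormSubgroup (v.adicCompletion K) x).index = 2)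
    {c d : K} (hc : c ≠ 0) (hd : d ≠ 0) (e : D ≃ₐ[K] ℍ[K,c,d]) {a : K}
    (hfin : ∀ v ∈ ramifiedPlaces K D, ¬ IsSquare (algebraMap K (v.adicCompletion K) a))
    (hinf : ∀ w ∈ ramifiedInfinitePlaces K D, ¬ IsSquare (algebraMap K w.Completion a))
    (L : Type) [Field L] [NumberField L] [Algebra K L] {r : L} (hr : r * r = algebraMap K L a)
    (hN : hilbertSymbol_eq_one_of_forall_completions L (algebraMap K L c) (algebraMap K L d)) :
    Nonempty (ScalarExtension K L D ≃ₐ[L] Matrix (Fin 2) (Fin 2) L) := by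
  have hcL : algebraMap K L c ≠ 0 := (map_ne_zero _).mpr hc
  have hdL : algebraMap K L d ≠ 0 := (map_ne_zero _).mpr hd
  -- `(c, d)_L = 1`
  have hsym : QuadraticForms.hilbertSymbol L (algebraMap K L c) (algebraMap K L d) = 1 := by
    by_cases hsq : IsSquare (algebraMap K L c)
    · exact QuadraticForms.hilbertSymbol_eq_one_of_isSquare hsq hcL _
    · exact hN hsq hdL
        (hilbertSymbol_adicCompletion_extension_eq_one K D hI hc hd e hfin L hr)
        (hilbertSymbol_infinitePlace_extension_eq_one K D hc hd e hinf L hr)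
  -- `L ⊗ D ≃ ℍ[L,c,d] ≃ M₂(L)`
  obtain ⟨e₁⟩ := ScalarExtension.nonempty_algEquiv_quaternionAlgebra (K := K) (F := L) (a := c)
    (b := d)
  obtain ⟨e₂⟩ := (QuaternionAlgebra.nonempty_algEquiv_matrix_iff hcL hdL).mpr
    ((QuadraticForms.exists_sq_sub_mul_sq_iff_hilbertSymbol_eq_one hcL hdL).mpr hsym)
  exact ⟨(ScalarExtension.congrRight (F := L) e).trans (e₁.trans e₂)⟩

/-- **Vignéras III §3 Thm. 3.8 (1) from the local norm index and Hasse's norm theorem.** If the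
local norm index `(K_vˣ : N(K_v(√x)ˣ)) = 2` holds for the non-squares `x ∈ K_v` at the finite
places `v` ramified in `D` (O'Meara 63:13a), and Hasse's norm theorem
(`hilbertSymbol_eq_one_of_forall_completions`, Cor. 3.4) holds over the quadratic extensions of
`K` (used for `L = K(√a)` = `QuadraticAlgebra K a 0`), then the named fact
`exists_sq_eq_of_not_isSquare_ramified K D` holds: with `D ≃ ℍ[K,c,d]`, `L` splits `D`
(`nonempty_algEquiv_matrix_scalarExtension_of_facts`) hence embeds in `D`
(`exists_mul_self_eq_of_nonempty_algEquiv_matrix`). [cite: VignerasLNM800, Ch. III §3 Thm. 3.8] -/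
theorem exists_sq_eq_of_not_isSquare_ramified_of_facts
    (hI : ∀ [IsQuaternionAlgebra K D], ∀ v ∈ ramifiedPlaces K D, ∀ x : v.adicCompletion K,
      x ≠ 0 → ¬ IsSquare x → (QuadraticForms.quadraticNormSubgroup (v.adicCompletion K) x).index = 2)
    (hN : ∀ (L : Type) [Field L] [NumberField L] [Algebra K L] (c d : L),
      hilbertSymbol_eq_one_of_forall_completions L c d) :
    exists_sq_eq_of_not_isSquare_ramified K D := by
  intro _ a ha hfin hinf
  haveI := fact_sq_ne_of_not_isSquare K a ha
  haveI := QuadraticAlgebra.numberField K a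
  obtain ⟨c, d, hc, hd, ⟨e⟩⟩ := IsQuaternionAlgebra.exists_algEquiv_quaternionAlgebra K D
  exact exists_mul_self_eq_of_nonempty_algEquiv_matrix K D (QuadraticAlgebra K a 0)
    (QuadraticAlgebra.finrank_eq_two a 0) (QuadraticAlgebra.omega_mul_omega_eq_algebraMap K a)
    (nonempty_algEquiv_matrix_scalarExtension_of_facts K D hI hc hd e hfin hinf
      (QuadraticAlgebra K a 0) (QuadraticAlgebra.omega_mul_omega_eq_algebraMap K a) (hN _ _ _))

/-- **Vignéras III §3 Thm. 3.8 (1), proved for algebras unramified above `2`**, granted only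
Hasse's norm theorem for quadratic extensions: if no dyadic place of `K` is ramified in `D`, the
local norm indices needed are those at places `v ∤ 2`, where they are proved
(`index_quadraticNormSubgroup_eq_two`, `QuadraticNormIndexLocal`).
[cite: VignerasLNM800, Ch. III §3 Thm. 3.8] -/
theorem exists_sq_eq_of_not_isSquare_ramified_of_hasseNorm_of_not_dyadic
    (h2 : ∀ [IsQuaternionAlgebra K D], ∀ v ∈ ramifiedPlaces K D, (2 : 𝓞 K) ∉ v.asIdeal)
    (hN : ∀ (L : Type) [Field L] [NumberField L] [Algebra K L] (c d : L),
      hilbertSymbol_eq_one_of_forall_completions L c d) :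
    exists_sq_eq_of_not_isSquare_ramified K D :=
  exists_sq_eq_of_not_isSquare_ramified_of_facts K D
    (fun v hv _ hx hxsq ↦ QuadraticForms.index_quadraticNormSubgroup_eq_two K v (h2 v hv) hx hxsq) hN

/-- **Vignéras III §3 Thm. 3.1 (uniqueness) from the local norm index and Hasse's norm
theorem.** The named fact `nonempty_algEquiv_of_ramifiedPlaces_eq K D` — two quaternion
algebras over the number field `K` with the same finite and infinite ramification are isomorphic —
follows from exactly two inputs: the local norm index `(K'_vˣ : N(K'_v(√x)ˣ)) = 2` for
non-squares `x` at the finite places of number fields (O'Meara 63:13a; proved at every `v ∤ 2`,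
`index_quadraticNormSubgroup_eq_two`), and Hasse's norm theorem for quadratic extensions of
number fields (Vignéras III Cor. 3.4, `hilbertSymbol_eq_one_of_forall_completions`). Everything
else in Vignéras' proof — Frobenius, base change, Wedderburn's dichotomy, I Cor. 2.2 and 2.4,
Lemme 3.6, the finiteness of ramification, II Thm. 1.1, III Cor. 3.5, Thm. 3.8 (1) and (2), and
all assemblies — is proved in this file and its imports. [cite: VignerasLNM800, Ch. III §3 Thm. 3.1] -/
theorem nonempty_algEquiv_of_ramifiedPlaces_eq_of_index_eq_two_of_hasseNorm
    (hI : ∀ (K : Type) [Field K] [NumberField K] (v : HeightOneSpectrum (𝓞 K))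
      (x : v.adicCompletion K), x ≠ 0 → ¬ IsSquare x →
        (QuadraticForms.quadraticNormSubgroup (v.adicCompletion K) x).index = 2)
    (hN : ∀ (L : Type) [Field L] [NumberField L] (c d : L),
      hilbertSymbol_eq_one_of_forall_completions L c d) :
    nonempty_algEquiv_of_ramifiedPlaces_eq.{u, v} K D :=
  nonempty_algEquiv_of_ramifiedPlaces_eq_of_leaves K D
    (nonempty_algEquiv_adicCompletion_of_division_of_index_eq_two hI) (hN K)
    (exists_sq_eq_of_not_isSquare_ramified_of_facts K D (fun v _ ↦ hI K v) fun L _ _ _ ↦ hN L)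
    fun D' _ _ ↦
      exists_sq_eq_of_not_isSquare_ramified_of_facts K D' (fun v _ ↦ hI K v) fun L _ _ _ ↦ hN L

/-- **Vignéras III §3 Thm. 3.1 (uniqueness) from 63:13a at the dyadic places and Hasse's norm
theorem**: since the local norm index is proved at every place `v ∤ 2`
(`index_quadraticNormSubgroup_eq_two`, `QuadraticNormIndexLocal`), only its instances at the
places above `2` of number fields remain as hypothesis, next to Hasse's norm theorem for
quadratic extensions. [cite: VignerasLNM800, Ch. III §3 Thm. 3.1] -/
theorem nonempty_algEquiv_of_ramifiedPlaces_eq_of_dyadic_index_eq_two_of_hasseNorm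
    (hI₂ : ∀ (K : Type) [Field K] [NumberField K] (v : HeightOneSpectrum (𝓞 K)),
      (2 : 𝓞 K) ∈ v.asIdeal → ∀ x : v.adicCompletion K, x ≠ 0 → ¬ IsSquare x →
        (QuadraticForms.quadraticNormSubgroup (v.adicCompletion K) x).index = 2)
    (hN : ∀ (L : Type) [Field L] [NumberField L] (c d : L),
      hilbertSymbol_eq_one_of_forall_completions L c d) :
    nonempty_algEquiv_of_ramifiedPlaces_eq.{u, v} K D := by
  refine nonempty_algEquiv_of_ramifiedPlaces_eq_of_index_eq_two_of_hasseNorm K D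
    (fun K _ _ v x hx hxsq ↦ ?_) hN
  by_cases h2 : (2 : 𝓞 K) ∈ v.asIdeal
  · exact hI₂ K v h2 x hx hxsq
  · exact QuadraticForms.index_quadraticNormSubgroup_eq_two K v h2 hx hxsq

/-- **Vignéras III §3 Thm. 3.1 (uniqueness) from local class field theory and Hasse's norm
theorem**: the same with the local norm index supplied by the fundamental equality
`[Fˣ : N_{E/F}(Eˣ)] = [E : F]` of local class field theory at the completions of number fields
(the named fact `index_normSubgroup_eq_finrank` of `LocalExistenceTheorem`, Serre *Local Fields*
XIII §4 Prop. 9; its quadratic case is 63:13a,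
`index_quadraticNormSubgroup_eq_two_of_index_normSubgroup_eq_finrank` of `QuadraticNormLocalCFT`).
[cite: VignerasLNM800, Ch. III §3 Thm. 3.1] -/
theorem nonempty_algEquiv_of_ramifiedPlaces_eq_of_localCFT_of_hasseNorm
    (hLCFT : ∀ (K : Type) [Field K] [NumberField K] (v : HeightOneSpectrum (𝓞 K)),
      GaloisRepresentations.index_normSubgroup_eq_finrank (v.adicCompletion K))
    (hN : ∀ (L : Type) [Field L] [NumberField L] (c d : L),
      hilbertSymbol_eq_one_of_forall_completions L c d) :
    nonempty_algEquiv_of_ramifiedPlaces_eq.{u, v} K D := by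
  refine nonempty_algEquiv_of_ramifiedPlaces_eq_of_index_eq_two_of_hasseNorm K D
    (fun K _ _ v x _ hxsq ↦ ?_) hN
  haveI : CharZero (v.adicCompletion K) :=
    charZero_of_injective_algebraMap (algebraMap K _).injective
  exact QuadraticForms.index_quadraticNormSubgroup_eq_two_of_index_normSubgroup_eq_finrank
    (v.adicCompletion K) (hLCFT K v) hxsq

end NumberField

end Literature.NumberTheory.Automorphic
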